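import Literature.AlgebraicGeometry.Resolution.TeissierPresentation
import Mathlib.RingTheory.AdjoinRoot
import Mathlib.Algebra.MvPolynomial.Equiv
import HarnessLib

/-!
# Eisenstein-type Weierstrass germs are Teissier-presented with `g = 1`
# (crux `TeissierJung.TeissierReduction`, stmt-ResolutionOfSingularities-17085, line `Sketch`,
# card `maclane-fan-residual-induction`, first lemma)

Let `Λ = k⟦x₀, …, x_{d-1}⟧` and let `f = z^e + a_{e-1} z^{e-1} + ⋯ + a_0 ∈ Λ[z]`, `e ≥ 2`, be an
EISENSTEIN-TYPE Weierstrass polynomial: every `a_i ∈ (x₀)` and `a_0 = x₀ · u` with `u` a unit.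
This is the germ of a finite cover at a general point of a branch divisor with separable residue
field extension. We prove that `Λ[z] ⧸ (f) = AdjoinRoot f` carries a Teissier presentation
(`Literature/AlgebraicGeometry/Resolution/TeissierPresentation`) with ONE step (`g = 1`):

* binomial `z^e − c x₀` with `c := −u(0) ≠ 0`, exponent `A₀ = e₀` (first basis vector), `μ₀ = 0`;
* weight `v₀ := e₀ / e`, so that `e • v₀ = e₀ = weight (x₀)` (homogeneity);
* tail `h₀ := Σ_i a_i z^i + c x₀`, whose `Λ`-coefficients are all divisible by `x₀` and whose
  `x₀ z⁰`-coefficient vanishes (`u(0) + c = 0`), hence OVERWEIGHT: a monomial `x^a z^j` of `h₀`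
  has `a₀ ≥ 1`, so weight `≥ e₀`, with equality only for `x₀ z⁰`, which does not occur;
* the binomial ideal `(z^e − c x₀) ⊂ k[x, z]` is prime: it is the kernel of the substitution
  `x₀ ↦ c⁻¹ z^e` (a retraction of `k[x, z]` onto the polynomials not involving `x₀`).

Main result: `stub_eisensteinGerm`. Helpers: `sub_aeval_update_mem_span` (`P − P(x_s ↦ q) ∈
(x_s − q)`), `ker_aeval_update` (the kernel of `x_s ↦ q` is `(x_s − q)` when `q` is fixed),
`isPrime_span_X_pow_sub_C_mul_X` (`(x_t^e − c x_s)` is prime for `s ≠ t`, `c ≠ 0`).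
Pure Mathlib algebra; no named facts.
-/

-- single-problem summit: the doubled namespace component `ResolutionOfSingularities` is forced
set_option linter.dupNamespace false

noncomputable section

open Polynomial (X C)
open Literature.AlgebraicGeometry.Resolution

namespace Summit.ResolutionOfSingularities.ResolutionOfSingularities.Theorems.TeissierReduction

/-- For the substitution `θ : x_s ↦ q` (the other variables fixed) and every polynomial `P`,
`P − θ P` lies in the ideal `(x_s − q)` ("`x_s − q` divides `P(x_s) − P(q)`"). [folklore] -/
theorem sub_aeval_update_mem_span {K σ : Type*} [Field K] [DecidableEq σ] (s : σ)
    (q P : MvPolynomial σ K) :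
    P - MvPolynomial.aeval (Function.update MvPolynomial.X s q) P ∈
      Ideal.span {(MvPolynomial.X s - q : MvPolynomial σ K)} := by
  induction P using MvPolynomial.induction_on with
  | C r => simp
  | add P Q hP hQ => rw [map_add, add_sub_add_comm]; exact add_mem hP hQ
  | mul_X P t hP =>
    rw [map_mul, MvPolynomial.aeval_X]
    by_cases ht : t = s
    · subst ht
      rw [Function.update_self]
      have key : P * MvPolynomial.X t - MvPolynomial.aeval (Function.update MvPolynomial.X t q) P * q
          = (P - MvPolynomial.aeval (Function.update MvPolynomial.X t q) P) * MvPolynomial.X t +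
            MvPolynomial.aeval (Function.update MvPolynomial.X t q) P * (MvPolynomial.X t - q) := by
        ring
      rw [key]
      exact add_mem (Ideal.mul_mem_right _ _ hP)
        (Ideal.mul_mem_left _ _ (Ideal.subset_span rfl))
    · rw [Function.update_of_ne ht, ← sub_mul]
      exact Ideal.mul_mem_right _ _ hP

/-- If `q` does not involve `x_s` (precisely: `q` is fixed by `x_s ↦ q`), the kernel of the
substitution `x_s ↦ q` is the principal ideal `(x_s − q)`. [folklore] -/
theorem ker_aeval_update {K σ : Type*} [Field K] [DecidableEq σ] (s : σ) (q : MvPolynomial σ K)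
    (hq : MvPolynomial.aeval (Function.update MvPolynomial.X s q) q = q) :
    RingHom.ker (MvPolynomial.aeval (R := K) (Function.update MvPolynomial.X s q)) =
      Ideal.span {(MvPolynomial.X s - q : MvPolynomial σ K)} := by
  apply le_antisymm
  · intro P hP
    have h := sub_aeval_update_mem_span s q P
    rwa [RingHom.mem_ker.1 hP, sub_zero] at h
  · rw [Ideal.span_le, Set.singleton_subset_iff, SetLike.mem_coe, RingHom.mem_ker, map_sub,
      MvPolynomial.aeval_X, Function.update_self, hq, sub_self]

/-- For distinct variables `x_s`, `x_t` and a nonzero scalar `c`, the ideal `(x_t^e − c x_s)` of a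
polynomial ring over a field is prime: it is the kernel of the substitution `x_s ↦ c⁻¹ x_t^e`
into the (integral) polynomial ring itself. [folklore] -/
theorem isPrime_span_X_pow_sub_C_mul_X {K σ : Type*} [Field K] [DecidableEq σ] (s t : σ)
    (hst : s ≠ t) (e : ℕ) (c : K) (hc : c ≠ 0) :
    (Ideal.span {(MvPolynomial.X t ^ e - MvPolynomial.C c * MvPolynomial.X s :
      MvPolynomial σ K)}).IsPrime := by
  set q : MvPolynomial σ K := MvPolynomial.C c⁻¹ * MvPolynomial.X t ^ e with hq_def
  have hq : MvPolynomial.aeval (Function.update MvPolynomial.X s q) q = q := by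
    simp only [hq_def, map_mul, map_pow, MvPolynomial.aeval_C, MvPolynomial.aeval_X,
      Function.update_of_ne (Ne.symm hst), MvPolynomial.algebraMap_eq]
  have hunit : IsUnit (-MvPolynomial.C c : MvPolynomial σ K) :=
    ((isUnit_iff_ne_zero.mpr hc).map MvPolynomial.C).neg
  have hCC : MvPolynomial.C c * MvPolynomial.C c⁻¹ = (1 : MvPolynomial σ K) := by
    rw [← map_mul, mul_inv_cancel₀ hc, map_one]
  have hB : (MvPolynomial.X t ^ e - MvPolynomial.C c * MvPolynomial.X s : MvPolynomial σ K) =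
      -MvPolynomial.C c * (MvPolynomial.X s - q) := by
    rw [hq_def]
    linear_combination (-(MvPolynomial.X t ^ e)) * hCC
  rw [hB, Ideal.span_singleton_mul_left_unit hunit, ← ker_aeval_update s q hq]
  exact RingHom.ker_isPrime _

/-- **Eisenstein-type Weierstrass germs are Teissier singularities with one step** (card
`maclane-fan-residual-induction`, first lemma; the generic point of a residually separable branch
divisor). For `f = z^e + a_{e-1} z^{e-1} + ⋯ + a_0` over `k⟦x₀, …, x_{d-1}⟧` with all
`a_i ∈ (x₀)` and `a_0 = x₀ · unit`, the germ `k⟦x⟧[z] ⧸ (f)` is Teissier-presented with `g = 1`: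
binomial `z^e − c x₀` (`c = −a₀/x₀ (0)`), weight `v₀ = e₀ / e`, and overweight tail
`Σ a_i z^i + c x₀` (all of whose monomials `x^a z^j` have `a₀ ≥ 1`, and `≠ x₀ z⁰`). -/
theorem stub_eisensteinGerm (k : Type) [Field k] (d e : ℕ) (hd : 0 < d) (he : 2 ≤ e)
    (a : Fin e → MvPowerSeries (Fin d) k)
    (ha : ∀ i, MvPowerSeries.X (⟨0, hd⟩ : Fin d) ∣ a i)
    (ha0 : ∃ u : (MvPowerSeries (Fin d) k)ˣ,
        a ⟨0, by omega⟩ = MvPowerSeries.X (⟨0, hd⟩ : Fin d) * (u : MvPowerSeries (Fin d) k)) :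
    TeissierPresentation k d
      (AdjoinRoot (X ^ e + ∑ i : Fin e, C (a i) * X ^ (i : ℕ) :
        Polynomial (MvPowerSeries (Fin d) k)))
      (AdjoinRoot.of (X ^ e + ∑ i : Fin e, C (a i) * X ^ (i : ℕ) :
        Polynomial (MvPowerSeries (Fin d) k))) := by
  classical
  obtain ⟨u, hu⟩ := ha0
  set i₀ : Fin d := ⟨0, hd⟩ with hi₀
  set f : Polynomial (MvPowerSeries (Fin d) k) := X ^ e + ∑ i : Fin e, C (a i) * X ^ (i : ℕ)
    with hf
  set c : k := -MvPowerSeries.constantCoeff (u : MvPowerSeries (Fin d) k) with hc_def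
  have hc : c ≠ 0 := neg_ne_zero.2 ((Units.isUnit u).map MvPowerSeries.constantCoeff).ne_zero
  have he0 : e ≠ 0 := by omega
  have heQ : (e : ℚ) ≠ 0 := by exact_mod_cast he0
  -- the tail `h₀ = Σ a_i z^i + c x₀`
  set H : MvPolynomial (Fin 1) (MvPowerSeries (Fin d) k) :=
    ∑ i : Fin e, MvPolynomial.C (a i) * MvPolynomial.X 0 ^ (i : ℕ) +
      MvPolynomial.C (MvPowerSeries.monomial (Finsupp.single i₀ 1) c) with hH
  -- the datum
  set n : Fin 1 → ℕ := fun _ => e with hn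
  set v : Fin 1 → (Fin d → ℚ) := fun _ j => if j = i₀ then (e : ℚ)⁻¹ else 0 with hv
  set c' : Fin 1 → k := fun _ => c with hc'
  set A : Fin 1 → (Fin d →₀ ℕ) := fun _ => Finsupp.single i₀ 1 with hA
  set mu : Fin 1 → (Fin 1 →₀ ℕ) := fun _ => 0 with hmu
  set h : Fin 1 → MvPolynomial (Fin 1) (MvPowerSeries (Fin d) k) := fun _ => H with hh
  /- 1. The equation: `core₀ = z^e + Σ a_i z^i`, and the ideal is principal on it. -/
  have hmon1 : (MvPolynomial.monomial (0 : Fin 1 →₀ ℕ) (1 : MvPowerSeries (Fin d) k)) = 1 := by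
    rw [← MvPolynomial.C_apply, MvPolynomial.C_1]
  have hcore : Teissier.core n c' A mu h 0 =
      MvPolynomial.X 0 ^ e + ∑ i : Fin e, MvPolynomial.C (a i) * MvPolynomial.X 0 ^ (i : ℕ) := by
    simp only [Teissier.core, hn, hc', hA, hmu, hh, hH, hmon1]
    ring
  have hideal : Teissier.ideal n c' A mu h = Ideal.span {Teissier.core n c' A mu h 0} := by
    unfold Teissier.ideal
    rw [Set.range_unique, Fin.default_eq_zero]
    unfold Teissier.equation
    rw [dif_neg (by norm_num)]
  /- 2. The ring isomorphism `Λ[z] ⧸ (f) ≃ Λ[u₀] ⧸ (core₀)` along `Λ[z] ≃ Λ[u₀]`, `z ↦ u₀`. -/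
  set Φ : Polynomial (MvPowerSeries (Fin d) k) ≃+* MvPolynomial (Fin 1) (MvPowerSeries (Fin d) k) :=
    (MvPolynomial.uniqueAlgEquiv (MvPowerSeries (Fin d) k) (Fin 1)).symm.toRingEquiv with hΦ
  have hΦX : Φ X = MvPolynomial.X 0 := by simp [hΦ]
  have hΦC : ∀ r, Φ (C r) = MvPolynomial.C r := fun r => by simp [hΦ]
  have hΦf : Φ f = Teissier.core n c' A mu h 0 := by
    rw [hcore]
    simp only [hf, map_add, map_pow, map_sum, map_mul, hΦX, hΦC]
  have hJ : Teissier.ideal n c' A mu h =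
      Ideal.map (Φ : Polynomial (MvPowerSeries (Fin d) k) →+* _) (Ideal.span {f}) := by
    rw [Ideal.map_span, Set.image_singleton, hideal, ← hΦf]
    rfl
  let ψ : AdjoinRoot f ≃+*
      (MvPolynomial (Fin 1) (MvPowerSeries (Fin d) k) ⧸ Teissier.ideal n c' A mu h) :=
    Ideal.quotientEquiv (Ideal.span {f}) (Teissier.ideal n c' A mu h) Φ hJ
  have hψ : ∀ r, ψ (AdjoinRoot.of f r) = Ideal.Quotient.mk _ (MvPolynomial.C r) := by
    intro r
    show Ideal.quotientEquiv _ _ Φ hJ (Ideal.Quotient.mk _ (C r)) = _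
    rw [Ideal.quotientEquiv_mk, hΦC]
  /- 3. The binomial ideal `(u₀^e − c x₀) ⊂ k[x, u₀]` is prime. -/
  have hsumElim : ((Finsupp.single i₀ 1 : Fin d →₀ ℕ).sumElim (0 : Fin 1 →₀ ℕ)) =
      Finsupp.single (Sum.inl i₀) 1 := by
    ext s
    rcases s with j | j
    · simp [Finsupp.single_apply]
    · simp
  have hbinomialIdeal : Teissier.binomialIdeal n c' A mu =
      Ideal.span {(MvPolynomial.X (Sum.inr 0) ^ e - MvPolynomial.C c * MvPolynomial.X (Sum.inl i₀) :
        MvPolynomial (Fin d ⊕ Fin 1) k)} := by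
    unfold Teissier.binomialIdeal
    rw [Set.range_unique, Fin.default_eq_zero]
    simp only [Teissier.binomial, hn, hc', hA, hmu, hsumElim]
    rfl
  /- 4. Coefficients of the tail: all divisible by `x₀`; the constant one is `x₀ (u + c)`. -/
  have hxmon : MvPowerSeries.monomial (Finsupp.single i₀ 1) c =
      MvPowerSeries.X i₀ * MvPowerSeries.C c := by
    rw [MvPowerSeries.X_def, ← MvPowerSeries.monomial_zero_eq_C_apply,
      MvPowerSeries.monomial_mul_monomial, add_zero, one_mul]
  have hHdvd : ∀ m, MvPowerSeries.X i₀ ∣ MvPolynomial.coeff m H := by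
    intro m
    simp only [hH, MvPolynomial.coeff_add, MvPolynomial.coeff_sum, MvPolynomial.coeff_C_mul,
      MvPolynomial.coeff_C]
    refine dvd_add (Finset.dvd_sum fun i _ => (ha i).mul_right _) ?_
    split_ifs
    · exact ⟨_, hxmon⟩
    · exact dvd_zero _
  have hH0 : MvPolynomial.coeff 0 H =
      MvPowerSeries.X i₀ * ((u : MvPowerSeries (Fin d) k) + MvPowerSeries.C c) := by
    rw [← MvPolynomial.constantCoeff_eq]
    simp only [hH, map_add, map_sum, map_mul, map_pow, MvPolynomial.constantCoeff_X,
      MvPolynomial.constantCoeff_C]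
    rw [Finset.sum_eq_single (⟨0, by omega⟩ : Fin e) (fun b _ hb => ?_)
      (fun hb => absurd (Finset.mem_univ _) hb)]
    · simp only [pow_zero, mul_one]
      rw [hu, hxmon, mul_add]
    · rw [zero_pow (fun hb0 => hb (Fin.ext hb0)), mul_zero]
  /- 5. Weights: `e • v₀ = e₀` and `weight v a' e' = a' + (e'₀ / e) e₀`. -/
  have hsmul : ∀ j, (e • v 0) j = if j = i₀ then (1 : ℚ) else 0 := by
    intro j
    simp only [hv, Pi.smul_apply, nsmul_eq_mul]
    split_ifs
    · exact mul_inv_cancel₀ heQ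
    · exact mul_zero _
  have hweight : ∀ (a' : Fin d →₀ ℕ) (e' : Fin 1 →₀ ℕ) (j : Fin d),
      Teissier.weight v a' e' j =
        (a' j : ℚ) + (e' 0 : ℚ) * (if j = i₀ then (e : ℚ)⁻¹ else 0) := by
    intro a' e' j
    rw [Teissier.weight_apply, Fin.sum_univ_one]
  /- 6. The tail is overweight. -/
  have hover : ∀ e' ∈ H.support, ∀ a' : Fin d →₀ ℕ,
      MvPowerSeries.coeff a' (H.coeff e') ≠ 0 →
        e • v 0 ≤ Teissier.weight v a' e' ∧ e • v 0 ≠ Teissier.weight v a' e' := by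
    intro e' _ a' hne
    have ha'0 : a' i₀ ≠ 0 := fun h0 => hne (MvPowerSeries.X_dvd_iff.1 (hHdvd e') a' h0)
    have ha'1 : (1 : ℚ) ≤ a' i₀ := by exact_mod_cast Nat.pos_of_ne_zero ha'0
    have hnn : (0 : ℚ) ≤ (e' 0 : ℚ) * (e : ℚ)⁻¹ := by positivity
    refine ⟨fun j => ?_, fun heq => ?_⟩
    · rw [hsmul, hweight]
      by_cases hj : j = i₀
      · subst hj
        rw [if_pos rfl, if_pos rfl]
        linarith
      · rw [if_neg hj, if_neg hj]
        simp
    · have h1 := congrFun heq i₀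
      rw [hsmul, hweight, if_pos rfl, if_pos rfl] at h1
      have he'0 : e' 0 = 0 := by
        have h2 : (e' 0 : ℚ) * (e : ℚ)⁻¹ = 0 := by linarith
        rcases mul_eq_zero.1 h2 with h3 | h3
        · exact_mod_cast h3
        · exact absurd h3 (inv_ne_zero heQ)
      have he' : e' = 0 := Finsupp.unique_ext (by simpa using he'0)
      have ha' : a' = Finsupp.single i₀ 1 := by
        ext j
        have hj := congrFun heq j
        rw [hsmul, hweight, he'0, Nat.cast_zero, zero_mul, add_zero] at hj
        rw [Finsupp.single_apply]
        by_cases hji : j = i₀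
        · subst hji
          rw [if_pos rfl] at hj
          rw [if_pos rfl]
          exact_mod_cast hj.symm
        · rw [if_neg hji] at hj
          rw [if_neg (Ne.symm hji)]
          exact_mod_cast hj.symm
      apply hne
      rw [he', ha', hH0, MvPowerSeries.X_def, MvPowerSeries.coeff_monomial_mul, if_pos le_rfl,
        tsub_self, one_mul, MvPowerSeries.coeff_zero_eq_constantCoeff_apply, map_add,
        MvPowerSeries.constantCoeff_C, hc_def, add_neg_cancel]
  /- 7. Assemble. -/
  refine ⟨1, n, v, c', A, mu, h, ⟨fun _ => he, fun _ => hc, fun _ j => ?_, fun _ _ _ => rfl,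
    fun i => ?_, fun i hi => absurd hi (by omega), fun i e' he' => ?_, ?_⟩, ψ, hψ⟩
  · -- weights are nonnegative
    show (0 : ℚ) ≤ if j = i₀ then (e : ℚ)⁻¹ else 0
    split_ifs
    · positivity
    · exact le_rfl
  · -- homogeneity `e • v₀ = weight(x₀)`
    obtain rfl : i = 0 := Subsingleton.elim _ _
    funext j
    show (e • v 0) j = Teissier.weight v (Finsupp.single i₀ 1) 0 j
    rw [hsmul, Teissier.weight_zero_right]
    simp only [Finsupp.single_apply]
    by_cases hj : j = i₀
    · subst hj; simp
    · simp [hj, Ne.symm hj]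
  · -- overweight
    obtain rfl : i = 0 := Subsingleton.elim _ _
    exact ⟨fun j hj => absurd hj (by omega), fun a' hne => hover e' he' a' hne⟩
  · -- the binomial ideal is prime
    rw [hbinomialIdeal]
    exact isPrime_span_X_pow_sub_C_mul_X _ _ Sum.inl_ne_inr e c hc

end Summit.ResolutionOfSingularities.ResolutionOfSingularities.Theorems.TeissierReduction

end
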